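import Summits.QuantumFields.YangMills.Theorems.UnitScaleTiltProp7ProjRangeKernelDecayCT
import HarnessLib

/-!
# Route `UnitScaleTilt`, crux K1 «MinimiserStabilityRegPr» (stmt-QuantumFields-19200), EX rows `h349` ∕ `hGF` (curved member) — **BRICK (L5′-core) OF LOCATE-P349-CT v2 §7
# (★p1 g24): THE K-UNIFORM «COARSE GRAM» FORM OF THE LOD LOCALISATION — `P = B M⁻¹ Bᴴ`, `M = Bᴴ B`, IS THE ORTHOGONAL PROJECTION ONTO `range B`, AND ITS FINE KERNEL DECAYS
# WITH THE WEIGHT `√w(x)√w(x′)` (print's `η³`) AS SOON AS THE COLUMNS OF `B` ARE WEIGHTED-EXPONENTIALLY LOCALISED AND `B` IS COERCIVE ON THE COARSE SPACE**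

Cell `ym3-torus` (HUMAN RULING D-0037, YM ladder rung R3 — NOT d = 4, NOT a mass gap, NOT Clay).  Fleet lead seat `ym-ust-19200-p1` gen 24; memo `LOCATE-P349-CT-p1g24.md` v2 §7
(ERRATUM + REPAIR; 19200 evidence).  THEOREMS ONLY (0 `def`, 0 `sorry`), Mathlib + lit ✓`B13Sqrt27AccretiveAlmostLocal.almostLocal_inverse_decay` + this seat's ✓`Prop7ProjRangeKernelDecayCT`
(§1 products); `--supports stmt-QuantumFields-19200 --as helper`, count-neutral.  HONEST LABEL (★★OWNER RULING №33 (6)): curved γ-row supplier line (LOD localisation), CONDITIONAL on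
the member bricks (L2′)–(L4′) of the memo — in particular on the Thm 3.1-class AGMON decay of the massive scalar propagator `G_a = (Δ_U + aQ″†Q″)⁻¹` (L3′); not the random-walk organ;
nothing of (3.49), `h349`, `hGF`, EX ∕ 19200 is proved here.

WHY THIS FORM (memo §7 (E1)–(E2)).  The fine-basis reading of ✓`Prop7ProjRangeKernelDecayCT` (projection `R = ΔP_NS⁻¹P_NΔ`, entry-budget Combes–Thomas on `S = P_NΔ²P_N + κ(1−P_N)`) carries
k-DEPENDENT constants at a member (face entries `~ η⁻⁴`, counts `~ L^{3(K−n)}`).  The K-uniform route writes the complementary projector through the MASSIVE scalar propagator: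
`(Δ_U ker Q″)^⊥ = G_a(range Q″†)`, so `P := 1 − R = B M⁻¹ Bᴴ` with `B := G_a Q″†` (coarse → fine) and the COARSE Gram operator `M := Bᴴ B = Q″ G_a² Q″†`.  On the coarse index set the
entry-budget Combes–Thomas IS K-uniform (O(1) entries, O(1) neighbour counts), and the fine kernel of `P` inherits the column profile of `B` — in an orthonormal fine basis the columns of
`B` have entries `≤ C_B·√w(x)·e^{−μ d(blk x, y)}` with `w(x) = c₀η³` the fine weight, which is where print's pointwise `η³` of (3.49) comes from.  This file is that algebra + bookkeeping,
abstractly: fine index `n`, coarse index `m`, block map `blk : n → m`, coarse pseudo-metric `dc`, weight `w ≥ 0`.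

WHAT IS PROVED (ns `Summit.QuantumFields.YangMills.Theorems.Prop7ProjRangeKernelDecayCoarseGram`; `B : Matrix n m ℂ`, `M = Bᴴ * B`, `P = B * M⁻¹ * Bᴴ` as defining hypotheses).
* §1 ★ `re_star_mulVec_gram` (`Re Σ c̄_y (M c)_y = Σ_x |(B c)_x|²`), ★★ `accretive_gram_of_coercive` (`m₀‖c‖² ≤ ‖Bc‖²` ⟹ `M` is `m₀`-accretive — THE slot for (L4′)), `isHermitian_gram`.
* §2 ★ `P_mul_B` (`P B = B`), ★ `P_mul_P`, ★ `isHermitian_P`, `P_eq_B_mul` — `P` IS the orthogonal projection onto `range B`.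
* §3 ★ `gram_entry_decay` — columns of `B` weighted-localised (`‖B x y‖ ≤ C_B √w(x) e^{−μ dc(blk x, y)}`, block weight sums `≤ W`, coarse volume growth `Σ_z e^{−(μ∕2)dc(z,y)} ≤ cV`)
  ⟹ `‖M y y′‖ ≤ C_B²·W·cV·e^{−(μ∕2) dc(y,y′)}`.
* §4 ★★★ `gram_inv_decay` (lit CT on the coarse index set: `m₀`-accretive + off-diagonal Schur budget `≤ m₀∕2` at rate `μ′` ⟹ `‖M⁻¹ y y′‖ ≤ (4∕m₀)e^{−μ′dc}`) and ★★★ `P_decay`: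
  `‖P x x′‖ ≤ (4∕m₀)·C_B²·cV′²·√w(x)·√w(x′)·e^{−μ′ dc(blk x, blk x′)}` for `μ′ ≤ μ` with `cV′` the volume constant at rate `μ − μ′` — THE (3.49) SHAPE WITH THE `η³`.

References: T. Bałaban, CMP **99** (1985) 389–434 [Balaban1985BackgroundPropagators] ((3.21) p.394, Thm 3.1 (3.42)–(3.47) pp.397–398, (3.49) p.399); CMP **116** (1988) 1–22
[Balaban1988RG2Cluster] ((2.7) p.13); A. Målqvist, D. Peterseim, Math. Comp. **83** (2014) 2583–2603.
-/

set_option autoImplicit false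

noncomputable section

open scoped Matrix ComplexConjugate BigOperators
open Finset

namespace Summit.QuantumFields.YangMills.Theorems.Prop7ProjRangeKernelDecayCoarseGram

open Literature.MathematicalPhysics.QuantumFieldTheory.Balaban1983to89.B13Sqrt27AccretiveAlmostLocal (almostLocal_inverse_decay)
open Summit.QuantumFields.YangMills.Theorems.Prop7ProjRangeKernelDecayCT (re_sum_star_mul_self)

variable {n m : Type*} [Fintype n] [Fintype m]

/-! ## §1 The coarse Gram operator `M = Bᴴ B`: form, accretivity, symmetry -/

/-- ★ `Re Σ_y c̄_y ((BᴴB)c)_y = Σ_x |(Bc)_x|²` (rectangular `B`). [cite: Balaban1985BackgroundPropagators, (3.21) p.394] -/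
theorem re_star_mulVec_gram (B : Matrix n m ℂ) (c : m → ℂ) :
    (∑ y, star (c y) * ((Bᴴ * B) *ᵥ c) y).re = ∑ x, ‖(B *ᵥ c) x‖ ^ 2 := by
  have h1 : ∑ y, star (c y) * ((Bᴴ * B) *ᵥ c) y = star c ⬝ᵥ ((Bᴴ * B) *ᵥ c) := rfl
  rw [h1, ← Matrix.mulVec_mulVec, Matrix.dotProduct_mulVec, ← Matrix.star_mulVec]
  exact re_sum_star_mul_self (B *ᵥ c)

/-- ★★ **ACCRETIVITY OF THE GRAM OPERATOR FROM COERCIVITY OF `B`** (the (L4′) slot: `m₀‖c‖² ≤ ‖G_aQ″†c‖²`). [cite: Balaban1985BackgroundPropagators, Thm 3.1 p.397] -/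
theorem accretive_gram_of_coercive (B : Matrix n m ℂ) {M : Matrix m m ℂ} (hM : M = Bᴴ * B) {m₀ : ℝ}
    (hcoer : ∀ c : m → ℂ, m₀ * ∑ y, ‖c y‖ ^ 2 ≤ ∑ x, ‖(B *ᵥ c) x‖ ^ 2) (c : m → ℂ) :
    m₀ * ∑ y, ‖c y‖ ^ 2 ≤ (∑ y, star (c y) * (M *ᵥ c) y).re := by
  rw [hM, re_star_mulVec_gram]; exact hcoer c

omit [Fintype m] in
/-- The Gram operator is Hermitian. [cite: Balaban1985BackgroundPropagators, (3.21) p.394] -/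
theorem isHermitian_gram (B : Matrix n m ℂ) {M : Matrix m m ℂ} (hM : M = Bᴴ * B) : M.IsHermitian := by
  rw [hM]; exact Matrix.isHermitian_conjTranspose_mul_self B

/-! ## §2 `P = B M⁻¹ Bᴴ` is the orthogonal projection onto `range B` -/

section Projector

variable [DecidableEq m] {B : Matrix n m ℂ} {M : Matrix m m ℂ} {P : Matrix n n ℂ}

/-- ★ **`P` FIXES `range B`**: `P B = B`. [cite: Balaban1985BackgroundPropagators, (3.21) p.394] -/
theorem P_mul_B (hM : M = Bᴴ * B) (hunit : IsUnit M.det) (hP : P = B * M⁻¹ * Bᴴ) : P * B = B := by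
  rw [hP, Matrix.mul_assoc, Matrix.mul_assoc, ← hM, Matrix.nonsing_inv_mul _ hunit, Matrix.mul_one]

/-- ★ **`P` IS IDEMPOTENT**. [cite: Balaban1985BackgroundPropagators, (3.21) p.394] -/
theorem P_mul_P (hM : M = Bᴴ * B) (hunit : IsUnit M.det) (hP : P = B * M⁻¹ * Bᴴ) : P * P = P := by
  have h := P_mul_B hM hunit hP
  calc P * P = P * B * (M⁻¹ * Bᴴ) := by rw [hP]; simp only [Matrix.mul_assoc]
    _ = B * (M⁻¹ * Bᴴ) := by rw [h]
    _ = P := by rw [hP]; simp only [Matrix.mul_assoc]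

/-- ★ **`P` IS HERMITIAN**. [cite: Balaban1985BackgroundPropagators, (3.21) p.394] -/
theorem isHermitian_P (hM : M = Bᴴ * B) (hP : P = B * M⁻¹ * Bᴴ) : P.IsHermitian := by
  have hMh := isHermitian_gram B hM
  show Pᴴ = P
  rw [hP, Matrix.conjTranspose_mul, Matrix.conjTranspose_mul, Matrix.conjTranspose_conjTranspose, hMh.inv.eq, Matrix.mul_assoc]

omit [Fintype n] in
/-- `P` factors through `B` (its range lies in `range B`); with `P_mul_B`, `P_mul_P`, `isHermitian_P`: `P` is THE orthogonal projection onto `range B`.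
[cite: Balaban1985BackgroundPropagators, (3.21) p.394] -/
theorem P_eq_B_mul (hP : P = B * M⁻¹ * Bᴴ) : ∃ W : Matrix m n ℂ, P = B * W := ⟨M⁻¹ * Bᴴ, by rw [hP, Matrix.mul_assoc]⟩

/-- On vectors: `P (B c) = B c`. [cite: Balaban1985BackgroundPropagators, (3.21) p.394] -/
theorem P_mulVec_range (hM : M = Bᴴ * B) (hunit : IsUnit M.det) (hP : P = B * M⁻¹ * Bᴴ) (c : m → ℂ) : P *ᵥ (B *ᵥ c) = B *ᵥ c := by
  rw [Matrix.mulVec_mulVec, P_mul_B hM hunit hP]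

end Projector

/-! ## §3 Weighted-localised columns give an exponentially decaying Gram operator -/

section GramDecay

variable (dc : m → m → ℝ) (blk : n → m) (w : n → ℝ)

/-- Regrouping a fine sum by blocks: `Σ_x f(blk x)·w(x) ≤ W·Σ_z f(z)` for `f ≥ 0` when every block's weight is `≤ W`. [cite: Balaban1985BackgroundPropagators, (3.11) p.392 (the `η^d` measure)] -/
theorem sum_blk_weight_le [DecidableEq m] {W : ℝ} (hW : ∀ z, ∑ x ∈ univ.filter (fun x => blk x = z), w x ≤ W)
    (f : m → ℝ) (hf : ∀ z, 0 ≤ f z) : ∑ x, f (blk x) * w x ≤ W * ∑ z, f z := by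
  classical
  rw [← Finset.sum_fiberwise_of_maps_to (s := univ) (t := univ) (g := blk) (fun x _ => Finset.mem_univ _)]
  rw [Finset.mul_sum]
  refine Finset.sum_le_sum fun z _ => ?_
  have h : ∑ x ∈ univ.filter (fun x => blk x = z), f (blk x) * w x = f z * ∑ x ∈ univ.filter (fun x => blk x = z), w x := by
    rw [Finset.mul_sum]
    refine Finset.sum_congr rfl fun x hx => ?_
    rw [(Finset.mem_filter.mp hx).2]
  rw [h, mul_comm W]
  exact mul_le_mul_of_nonneg_left (hW z) (hf z)

/-- ★ **GRAM ENTRY DECAY**: `‖B x y‖ ≤ C_B·√w(x)·e^{−μ dc(blk x, y)}`, block weights `≤ W`, coarse volume growth `Σ_z e^{−(μ∕2)dc(z,y)} ≤ cV` ⟹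
`‖(BᴴB) y y′‖ ≤ C_B²·W·cV·e^{−(μ∕2)dc(y,y′)}`. [cite: Balaban1985BackgroundPropagators, Thm 3.1 (3.46) p.398] -/
theorem gram_entry_decay [DecidableEq m] (hds : ∀ i j, dc i j = dc j i) (hdt : ∀ i j k, dc i k ≤ dc i j + dc j k) (hdnn : ∀ i j, 0 ≤ dc i j)
    (B : Matrix n m ℂ) {M : Matrix m m ℂ} (hM : M = Bᴴ * B)
    {CB μ W cV : ℝ} (hCB : 0 ≤ CB) (hμ : 0 ≤ μ) (hW0 : 0 ≤ W) (hw : ∀ x, 0 ≤ w x)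
    (hB : ∀ x y, ‖B x y‖ ≤ CB * Real.sqrt (w x) * Real.exp (-(μ * dc (blk x) y)))
    (hW : ∀ z, ∑ x ∈ univ.filter (fun x => blk x = z), w x ≤ W) (hvol : ∀ y, ∑ z, Real.exp (-(μ / 2 * dc z y)) ≤ cV) (y y' : m) :
    ‖M y y'‖ ≤ CB ^ 2 * W * cV * Real.exp (-(μ / 2 * dc y y')) := by
  rw [hM, Matrix.mul_apply]
  refine (norm_sum_le _ _).trans ?_
  -- termwise: `‖B̄ x y · B x y'‖ ≤ CB² w(x) e^{−μ(d(z,y)+d(z,y'))} ≤ CB² w(x) e^{−(μ/2)d(y,y')} e^{−(μ/2) d(z,y)}`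
  have hterm : ∀ x, ‖(Bᴴ y x) * B x y'‖ ≤ (CB ^ 2 * Real.exp (-(μ / 2 * dc y y'))) * (Real.exp (-(μ / 2 * dc (blk x) y)) * w x) := by
    intro x
    rw [norm_mul, Matrix.conjTranspose_apply, norm_star]
    have h1 := hB x y
    have h2 := hB x y'
    have hsq : Real.sqrt (w x) * Real.sqrt (w x) = w x := Real.mul_self_sqrt (hw x)
    have hexp : Real.exp (-(μ * dc (blk x) y)) * Real.exp (-(μ * dc (blk x) y')) ≤ Real.exp (-(μ / 2 * dc y y')) * Real.exp (-(μ / 2 * dc (blk x) y)) := by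
      rw [← Real.exp_add, ← Real.exp_add]
      apply Real.exp_le_exp.mpr
      have ht := hdt y (blk x) y'
      rw [hds y (blk x)] at ht
      have hnn : 0 ≤ dc (blk x) y' := hdnn (blk x) y'
      nlinarith [mul_le_mul_of_nonneg_left ht hμ, mul_nonneg hμ hnn]
    have hnn1 : 0 ≤ CB * Real.sqrt (w x) := mul_nonneg hCB (Real.sqrt_nonneg _)
    calc ‖B x y‖ * ‖B x y'‖ ≤ (CB * Real.sqrt (w x) * Real.exp (-(μ * dc (blk x) y))) * (CB * Real.sqrt (w x) * Real.exp (-(μ * dc (blk x) y'))) :=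
          mul_le_mul h1 h2 (norm_nonneg _) (by positivity)
      _ = CB ^ 2 * (Real.sqrt (w x) * Real.sqrt (w x)) * (Real.exp (-(μ * dc (blk x) y)) * Real.exp (-(μ * dc (blk x) y'))) := by ring
      _ ≤ CB ^ 2 * (Real.sqrt (w x) * Real.sqrt (w x)) * (Real.exp (-(μ / 2 * dc y y')) * Real.exp (-(μ / 2 * dc (blk x) y))) := by gcongr
      _ = (CB ^ 2 * Real.exp (-(μ / 2 * dc y y'))) * (Real.exp (-(μ / 2 * dc (blk x) y)) * w x) := by rw [hsq]; ring
  refine (Finset.sum_le_sum fun x _ => hterm x).trans ?_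
  rw [← Finset.mul_sum]
  have hblk := sum_blk_weight_le blk w hW (fun z => Real.exp (-(μ / 2 * dc z y))) (fun z => (Real.exp_pos _).le)
  have hnn : 0 ≤ CB ^ 2 * Real.exp (-(μ / 2 * dc y y')) := by positivity
  calc CB ^ 2 * Real.exp (-(μ / 2 * dc y y')) * ∑ x, Real.exp (-(μ / 2 * dc (blk x) y)) * w x
      ≤ CB ^ 2 * Real.exp (-(μ / 2 * dc y y')) * (W * cV) :=
        mul_le_mul_of_nonneg_left (hblk.trans (mul_le_mul_of_nonneg_left (hvol y) hW0)) hnn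
    _ = CB ^ 2 * W * cV * Real.exp (-(μ / 2 * dc y y')) := by ring

end GramDecay

/-! ## §4 Combes–Thomas on the coarse index set and the decay of `P` with the weight `√w(x)√w(x′)` -/

section PDecay

variable [DecidableEq m] (dc : m → m → ℝ) (blk : n → m) (w : n → ℝ)

/-- ★★★ **COMBES–THOMAS FOR THE COARSE GRAM OPERATOR** (lit ✓`almostLocal_inverse_decay`): `m₀`-coercive `B` and the off-diagonal Schur budget of `M = BᴴB` at rate `μ′` at most
`m₀∕2` give `‖M⁻¹ y y′‖ ≤ (4∕m₀)·e^{−μ′ dc(y,y′)}` — K-uniform at a member because the coarse index set has O(1) entries and O(1) neighbour counts.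
[cite: Balaban1985BackgroundPropagators, (3.49) p.399; Balaban1988RG2Cluster, (2.7) p.13] -/
theorem gram_inv_decay (hd0 : ∀ i, dc i i = 0) (hds : ∀ i j, dc i j = dc j i) (hdt : ∀ i j k, dc i k ≤ dc i j + dc j k)
    (B : Matrix n m ℂ) {M : Matrix m m ℂ} (hM : M = Bᴴ * B) {m₀ μ' ϱ : ℝ} (hm₀ : 0 < m₀)
    (hcoer : ∀ c : m → ℂ, m₀ * ∑ y, ‖c y‖ ^ 2 ≤ ∑ x, ‖(B *ᵥ c) x‖ ^ 2)
    (hμ' : 0 ≤ μ') (hϱ : 0 ≤ ϱ) (hϱm : ϱ ≤ m₀ / 2)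
    (hrow : ∀ y, ∑ y', ‖M y y'‖ * (Real.exp (μ' * dc y y') - 1) ≤ ϱ) (hcol : ∀ y', ∑ y, ‖M y y'‖ * (Real.exp (μ' * dc y y') - 1) ≤ ϱ) :
    IsUnit M.det ∧ ∀ y y', ‖M⁻¹ y y'‖ ≤ 4 / m₀ * Real.exp (-(μ' * dc y y')) :=
  almostLocal_inverse_decay dc hd0 hds hdt M hm₀ hμ' hϱ hϱm (accretive_gram_of_coercive B hM hcoer) hrow hcol

/-- A three-point exponential bound: `e^{−μa}e^{−μ′b}e^{−μc} ≤ e^{−μ′ t}·e^{−(μ−μ′)a}·e^{−(μ−μ′)c}` when `t ≤ a + b + c`, `0 ≤ μ′`.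
[cite: Balaban1985BackgroundPropagators, p.415] -/
theorem exp_three_le {μ μ' a b c t : ℝ} (hμ' : 0 ≤ μ') (ht : t ≤ a + b + c) :
    Real.exp (-(μ * a)) * Real.exp (-(μ' * b)) * Real.exp (-(μ * c))
      ≤ Real.exp (-(μ' * t)) * (Real.exp (-((μ - μ') * a)) * Real.exp (-((μ - μ') * c))) := by
  rw [← Real.exp_add, ← Real.exp_add, ← Real.exp_add, ← Real.exp_add]
  apply Real.exp_le_exp.mpr
  nlinarith [mul_le_mul_of_nonneg_left ht hμ']

omit [Fintype n] in
/-- ★★★ **THE (3.49) SHAPE WITH THE `η³`**: if the columns of `B` are weighted-localised at rate `μ` (`‖B x y‖ ≤ C_B√w(x)e^{−μ dc(blk x,y)}`), `M⁻¹` decays at rate `μ′ ≤ μ`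
(`‖M⁻¹ y y′‖ ≤ C_M e^{−μ′dc(y,y′)}`) and the coarse volume growth at rate `μ − μ′` is `≤ cV′` (useful for `μ′ < μ`), then for `P = B M⁻¹ Bᴴ`:
`‖P x x′‖ ≤ C_B²·C_M·cV′²·√w(x)·√w(x′)·e^{−μ′ dc(blk x, blk x′)}`. [cite: Balaban1985BackgroundPropagators, (3.49) p.399] -/
theorem P_decay (hds : ∀ i j, dc i j = dc j i) (hdt : ∀ i j k, dc i k ≤ dc i j + dc j k)
    (B : Matrix n m ℂ) {M : Matrix m m ℂ} {P : Matrix n n ℂ} (hP : P = B * M⁻¹ * Bᴴ)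
    {CB CM μ μ' cV' : ℝ} (hCB : 0 ≤ CB) (hCM : 0 ≤ CM) (hμ' : 0 ≤ μ')
    (hB : ∀ x y, ‖B x y‖ ≤ CB * Real.sqrt (w x) * Real.exp (-(μ * dc (blk x) y)))
    (hMinv : ∀ y y', ‖M⁻¹ y y'‖ ≤ CM * Real.exp (-(μ' * dc y y')))
    (hvol' : ∀ y, ∑ z, Real.exp (-((μ - μ') * dc z y)) ≤ cV') (x x' : n) :
    ‖P x x'‖ ≤ CB ^ 2 * CM * cV' ^ 2 * Real.sqrt (w x) * Real.sqrt (w x') * Real.exp (-(μ' * dc (blk x) (blk x'))) := by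
  have hcV' : 0 ≤ cV' := le_trans (Finset.sum_nonneg fun z _ => (Real.exp_pos _).le) (hvol' (blk x))
  rw [hP, Matrix.mul_assoc, Matrix.mul_apply]
  refine (norm_sum_le _ _).trans ?_
  -- inner entry: `(M⁻¹ Bᴴ) y x' = Σ_{y'} M⁻¹ y y' · conj (B x' y')`
  have hinner : ∀ y, ‖(M⁻¹ * Bᴴ) y x'‖ ≤ CM * CB * Real.sqrt (w x') * ∑ y', Real.exp (-(μ' * dc y y')) * Real.exp (-(μ * dc (blk x') y')) := by
    intro y
    rw [Matrix.mul_apply]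
    refine (norm_sum_le _ _).trans ?_
    rw [Finset.mul_sum]
    refine Finset.sum_le_sum fun y' _ => ?_
    rw [norm_mul, Matrix.conjTranspose_apply, norm_star]
    calc ‖M⁻¹ y y'‖ * ‖B x' y'‖ ≤ (CM * Real.exp (-(μ' * dc y y'))) * (CB * Real.sqrt (w x') * Real.exp (-(μ * dc (blk x') y'))) :=
          mul_le_mul (hMinv y y') (hB x' y') (norm_nonneg _) (by positivity)
      _ = CM * CB * Real.sqrt (w x') * (Real.exp (-(μ' * dc y y')) * Real.exp (-(μ * dc (blk x') y'))) := by ring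
  have hterm : ∀ y, ‖B x y * (M⁻¹ * Bᴴ) y x'‖ ≤ CB ^ 2 * CM * Real.sqrt (w x) * Real.sqrt (w x') * Real.exp (-(μ' * dc (blk x) (blk x'))) *
      (Real.exp (-((μ - μ') * dc (blk x) y)) * ∑ y', Real.exp (-((μ - μ') * dc (blk x') y'))) := by
    intro y
    rw [norm_mul]
    have h1 := hB x y
    have h2 := hinner y
    have hprod : Real.exp (-(μ * dc (blk x) y)) * ∑ y', Real.exp (-(μ' * dc y y')) * Real.exp (-(μ * dc (blk x') y'))
        ≤ Real.exp (-(μ' * dc (blk x) (blk x'))) * (Real.exp (-((μ - μ') * dc (blk x) y)) * ∑ y', Real.exp (-((μ - μ') * dc (blk x') y'))) := by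
      rw [Finset.mul_sum, Finset.mul_sum, Finset.mul_sum]
      refine Finset.sum_le_sum fun y' _ => ?_
      have ht : dc (blk x) (blk x') ≤ dc (blk x) y + dc y y' + dc (blk x') y' := by
        have := hdt (blk x) y (blk x'); have h2 := hdt y y' (blk x'); rw [hds y' (blk x')] at h2; linarith
      have h3 := exp_three_le (μ := μ) (a := dc (blk x) y) (b := dc y y') (c := dc (blk x') y') hμ' ht
      calc Real.exp (-(μ * dc (blk x) y)) * (Real.exp (-(μ' * dc y y')) * Real.exp (-(μ * dc (blk x') y')))
          = Real.exp (-(μ * dc (blk x) y)) * Real.exp (-(μ' * dc y y')) * Real.exp (-(μ * dc (blk x') y')) := by ring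
        _ ≤ Real.exp (-(μ' * dc (blk x) (blk x'))) * (Real.exp (-((μ - μ') * dc (blk x) y)) * Real.exp (-((μ - μ') * dc (blk x') y'))) := h3
    calc ‖B x y‖ * ‖(M⁻¹ * Bᴴ) y x'‖
        ≤ (CB * Real.sqrt (w x) * Real.exp (-(μ * dc (blk x) y))) * (CM * CB * Real.sqrt (w x') * ∑ y', Real.exp (-(μ' * dc y y')) * Real.exp (-(μ * dc (blk x') y'))) :=
          mul_le_mul h1 h2 (norm_nonneg _) (by positivity)
      _ = CB ^ 2 * CM * Real.sqrt (w x) * Real.sqrt (w x') * (Real.exp (-(μ * dc (blk x) y)) * ∑ y', Real.exp (-(μ' * dc y y')) * Real.exp (-(μ * dc (blk x') y'))) := by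
          ring
      _ ≤ CB ^ 2 * CM * Real.sqrt (w x) * Real.sqrt (w x') *
            (Real.exp (-(μ' * dc (blk x) (blk x'))) * (Real.exp (-((μ - μ') * dc (blk x) y)) * ∑ y', Real.exp (-((μ - μ') * dc (blk x') y')))) :=
          mul_le_mul_of_nonneg_left hprod (by positivity)
      _ = _ := by ring
  refine (Finset.sum_le_sum fun y _ => hterm y).trans ?_
  rw [← Finset.mul_sum]
  have hsum : ∑ y, Real.exp (-((μ - μ') * dc (blk x) y)) * ∑ y', Real.exp (-((μ - μ') * dc (blk x') y')) ≤ cV' * cV' := by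
    rw [← Finset.sum_mul]
    have ha : ∑ y, Real.exp (-((μ - μ') * dc (blk x) y)) ≤ cV' := by
      have := hvol' (blk x); simpa [hds] using this
    have hb : ∑ y', Real.exp (-((μ - μ') * dc (blk x') y')) ≤ cV' := by
      have := hvol' (blk x'); simpa [hds] using this
    exact mul_le_mul ha hb (Finset.sum_nonneg fun _ _ => (Real.exp_pos _).le) hcV'
  have hnn : 0 ≤ CB ^ 2 * CM * Real.sqrt (w x) * Real.sqrt (w x') * Real.exp (-(μ' * dc (blk x) (blk x'))) := by positivity
  calc CB ^ 2 * CM * Real.sqrt (w x) * Real.sqrt (w x') * Real.exp (-(μ' * dc (blk x) (blk x'))) *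
        ∑ y, Real.exp (-((μ - μ') * dc (blk x) y)) * ∑ y', Real.exp (-((μ - μ') * dc (blk x') y'))
      ≤ CB ^ 2 * CM * Real.sqrt (w x) * Real.sqrt (w x') * Real.exp (-(μ' * dc (blk x) (blk x'))) * (cV' * cV') :=
        mul_le_mul_of_nonneg_left hsum hnn
    _ = CB ^ 2 * CM * cV' ^ 2 * Real.sqrt (w x) * Real.sqrt (w x') * Real.exp (-(μ' * dc (blk x) (blk x'))) := by ring

end PDecay

end Summit.QuantumFields.YangMills.Theorems.Prop7ProjRangeKernelDecayCoarseGram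

end
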